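import Mathlib
import Literature.NumberTheory.Automorphic.UnitaryGroupAutomorphicRep   -- ★ `unitaryGroupOfForm σ J`, `mem_unitaryGroupOfForm_iff`
import HarnessLib

/-!
# Brick «CAYLEY★» (LH6, package (S-𝔇)∕(T3)): the Cayley transform `γ = (1+X)(1−X)⁻¹` of an element `X` of the Lie algebra
# `𝔲(σ, J) = {X | (σX)ᵀ J = −J X}` lies in the unitary group `U(σ, J)`; `1 ± X` are invertible off the roots `±1` of `χ_X`;
# and a rootless (irreducible, cubic) `χ_X` gives a rootless (irreducible) `χ_γ`

Cell `hodgecm-mathlib`, crux H413 (`stmt-HodgeConjecture-24833`), half A line LH6 (closer stub `stub_StCharTS`, leaf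
`Cruxes/H413/Lines/F0_P3c_StCharTSPaydown.lean`, organ (S-𝔇) ∕ test-element package (T3)); DEAL «CAYLEY★» of F0P3b-plan (g23)
2026-09-02T05:14:38Z to LH1-p01 (g3) = the GENERIC half of «T3-ALG★» (LH1-p03 (g2) builds an `X ∈ 𝔲(conjLocal, Φ₃)` with Eisenstein
characteristic polynomial and calls this file BY NAME to get a regular elliptic `γ ∈ U(Φ₃)`).  PROOF lane: theorems only (no `def`, no instance,
no notation, no named fact, no `sorry`); pure matrix algebra over a commutative ring `R` (a field `K` in §2–§3), Mathlib + ★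
`Literature.NumberTheory.Automorphic.UnitaryGroupAutomorphicRep` (`unitaryGroupOfForm σ J = {g ∈ GL_n | (σg)ᵀ J g = J}`).

Throughout `γ` is the TERM `(1 + X) * (1 - X)⁻¹` (Mathlib's `Matrix` non-singular inverse); no definition is introduced.

* §1 (C1) **`transpose_map_mul_form_mul_cayley`**: `(σX)ᵀ J = −J X` and `1 − X` invertible ⇒ `(σγ)ᵀ J γ = J` — the classical Cayley identity,
  proved WITHOUT mapping an inverse: from `γ(1−X) = 1+X` one gets `(1−Y)(σγ)ᵀ = 1+Y` (`Y := (σX)ᵀ`), and `(1−Y)·((σγ)ᵀ J γ) = (1+Y) J γ =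
  J(1−X)γ = J(1+X) = (1−Y) J`, then cancel the unit `1−Y` (`det(1−Y) = σ(det(1−X))`).  Packaged: **`isUnit_cayley`** (`1 ± X` units ⇒ `γ` a unit),
  **`mem_unitaryGroupOfForm_of_coe_eq_cayley`** (any `g : GL n R` with `↑g = γ` lies in ★ `unitaryGroupOfForm σ J`), **`mem_unitaryGroupOfForm_cayley`**,
  **`exists_mem_unitaryGroupOfForm_coe_eq_cayley`**.
* §2 (C2) `det(1 − X) = χ_X(1)`, `det(1 + X) = (−1)ⁿ χ_X(−1)` (★ Mathlib `Matrix.eval_charpoly`), hence **`isUnit_one_sub_of_not_isRoot`** ∕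
  **`isUnit_one_add_of_not_isRoot`** over a field and **`isUnit_one_sub_and_one_add_of_irreducible`** (`χ_X` irreducible, `n ≥ 2` ⇒ no roots,
  Mathlib `Irreducible.not_isRoot_of_natDegree_ne_one`).
* §3 (C3′)+(C3) **`eval_charpoly_cayley`** (`χ_γ(c) = det((c−1)·1 − (c+1)·X) · det(1−X)⁻¹`), **`not_isRoot_charpoly_cayley`** (`χ_X` rootless, `2 ≠ 0`
  ⇒ `χ_γ` rootless: for `c ≠ −1` the determinant is `(c+1)ⁿ χ_X((c−1)/(c+1))`, for `c = −1` it is `(−2)ⁿ`), **`irreducible_charpoly_cayley`**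
  (`2 ≤ n ≤ 3`: rootless ⟺ irreducible, Mathlib `Polynomial.irreducible_of_degree_le_three_of_not_isRoot`) and the `Fin 3` instance
  **`irreducible_charpoly_cayley_fin_three`**.

HONEST LABEL.  Count-neutral kit for the LH6 package (S-𝔇)∕(T3); nothing printed is discharged here.  HC_CM is proved only modulo the 7 printed
citations (2 remaining: hLiu418 = stmt-HodgeConjecture-24832, h413 = stmt-HodgeConjecture-24833) until rung 0 closes.

## References
* [Rogawski1990] J. D. Rogawski, *Automorphic Representations of Unitary Groups in Three Variables*, Ann. of Math. Stud. 123 (1990) — §3.1 p. 19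
  (regular elements), §12.5–12.6 (elliptic test elements at the archimedean∕𝔭-adic places).
* [Mok2014] C. P. Mok, *Endoscopic classification of representations of quasi-split unitary groups*, Mem. AMS 235 (2015) — §1 Notation p. 5
  (`U_{E/F}(N) = {g | ᵗc(g) J g = J}`).
* A. Weil, *Algebras with involutions and the classical groups*, J. Indian Math. Soc. 24 (1960) — the Cayley parametrisation `g = (1+X)(1−X)⁻¹`.
-/

set_option autoImplicit false
set_option linter.dupNamespace false

namespace Summit.HodgeConjecture.HodgeConjecture.Cruxes.H413.F0P3cStCharTSCayleyUnitary

open Matrix Polynomial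
open Literature.NumberTheory.Automorphic

/-! ## §1 (C1) The Cayley transform lands in `U(σ, J)` -/

section Cayley

variable {R : Type*} [CommRing R] {n : Type*} [Fintype n] [DecidableEq n]

/-- `1 − X` and `1 + X` commute. [folklore] -/
theorem one_sub_mul_one_add_comm (X : Matrix n n R) : (1 - X) * (1 + X) = (1 + X) * (1 - X) := by
  noncomm_ring

/-- `γ (1 − X) = 1 + X` for `γ = (1+X)(1−X)⁻¹`, `1 − X` invertible. [folklore] -/
theorem cayley_mul_one_sub {X : Matrix n n R} (h₁ : IsUnit (1 - X)) : (1 + X) * (1 - X)⁻¹ * (1 - X) = 1 + X := by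
  rw [Matrix.mul_assoc, Matrix.nonsing_inv_mul _ ((Matrix.isUnit_iff_isUnit_det _).1 h₁), Matrix.mul_one]

/-- `(1 − X) γ = 1 + X` for `γ = (1+X)(1−X)⁻¹`, `1 − X` invertible (`1 ± X` commute). [folklore] -/
theorem one_sub_mul_cayley {X : Matrix n n R} (h₁ : IsUnit (1 - X)) : (1 - X) * ((1 + X) * (1 - X)⁻¹) = 1 + X := by
  rw [← Matrix.mul_assoc, one_sub_mul_one_add_comm, Matrix.mul_assoc,
    Matrix.mul_nonsing_inv _ ((Matrix.isUnit_iff_isUnit_det _).1 h₁), Matrix.mul_one]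

/-- **`γ = (1+X)(1−X)⁻¹` is invertible when `1 − X` and `1 + X` are.** [folklore] -/
theorem isUnit_cayley {X : Matrix n n R} (h₁ : IsUnit (1 - X)) (h₂ : IsUnit (1 + X)) : IsUnit ((1 + X) * (1 - X)⁻¹) :=
  h₂.mul (Matrix.isUnit_nonsing_inv_iff.2 h₁)

/-- **(C1) THE CAYLEY IDENTITY `(σγ)ᵀ J γ = J`.**  If `X` lies in the Lie algebra of the form — `(σX)ᵀ J = −J X` — and `1 − X` is invertible, then
the Cayley transform `γ = (1+X)(1−X)⁻¹` preserves `J`: `(γ.map σ)ᵀ * J * γ = J`.  Proof without mapping an inverse: `σ`, applied to `γ(1−X) = 1+X`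
and transposed, gives `(1−Y)(σγ)ᵀ = 1+Y` with `Y := (σX)ᵀ`; the hypothesis gives `(1+Y)J = J(1−X)` and `(1−Y)J = J(1+X)`; hence
`(1−Y)·((σγ)ᵀ J γ) = J(1−X)γ = J(1+X) = (1−Y)J`, and `1−Y = (σ(1−X))ᵀ` is invertible. [cite: Mok2014, §1 Notation p. 5] -/
theorem transpose_map_mul_form_mul_cayley (σ : R →+* R) {J X : Matrix n n R} (hX : (X.map σ)ᵀ * J = -(J * X))
    (h₁ : IsUnit (1 - X)) :
    (((1 + X) * (1 - X)⁻¹).map σ)ᵀ * J * ((1 + X) * (1 - X)⁻¹) = J := by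
  set γ : Matrix n n R := (1 + X) * (1 - X)⁻¹ with hγ
  set Y : Matrix n n R := (X.map σ)ᵀ with hY
  -- `σ` applied to `γ (1 − X) = 1 + X`
  have hσ : γ.map σ * (1 - X.map σ) = 1 + X.map σ := by
    have h := congrArg (σ.mapMatrix) (cayley_mul_one_sub h₁)
    rw [map_mul, map_sub, map_add, map_one] at h
    simpa only [RingHom.mapMatrix_apply] using h
  -- transposed: `(1 − Y) (σγ)ᵀ = 1 + Y`
  have hT : (1 - Y) * (γ.map σ)ᵀ = 1 + Y := by
    have h := congrArg Matrix.transpose hσ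
    rw [Matrix.transpose_mul, Matrix.transpose_sub, Matrix.transpose_add, Matrix.transpose_one] at h
    rw [hY]
    exact h
  -- the Lie-algebra condition, twice
  have hJ1 : (1 - Y) * J = J * (1 + X) := by
    rw [sub_mul, one_mul, hY, hX, mul_add, mul_one, sub_neg_eq_add]
  have hJ2 : (1 + Y) * J = J * (1 - X) := by
    rw [add_mul, one_mul, hY, hX, mul_sub, mul_one, sub_eq_add_neg]
  -- `1 − Y` is invertible: `det (1 − Y) = σ (det (1 − X))`
  have hYu : IsUnit (1 - Y).det := by
    have hmat : 1 - Y = ((1 - X).map σ)ᵀ := by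
      rw [hY, ← RingHom.mapMatrix_apply, ← RingHom.mapMatrix_apply, map_sub, map_one, Matrix.transpose_sub,
        Matrix.transpose_one]
    rw [hmat, Matrix.det_transpose, ← RingHom.mapMatrix_apply, ← RingHom.map_det]
    exact ((Matrix.isUnit_iff_isUnit_det _).1 h₁).map σ
  -- the identity multiplied by `1 − Y`
  have key : (1 - Y) * ((γ.map σ)ᵀ * J * γ) = (1 - Y) * J := by
    calc (1 - Y) * ((γ.map σ)ᵀ * J * γ) = (1 - Y) * (γ.map σ)ᵀ * J * γ := by simp only [Matrix.mul_assoc]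
      _ = (1 + Y) * J * γ := by rw [hT]
      _ = J * ((1 - X) * γ) := by rw [hJ2, Matrix.mul_assoc]
      _ = J * (1 + X) := by rw [hγ, one_sub_mul_cayley h₁]
      _ = (1 - Y) * J := hJ1.symm
  -- cancel `1 − Y`
  have h := congrArg (fun M : Matrix n n R => (1 - Y)⁻¹ * M) key
  simp only [← Matrix.mul_assoc, Matrix.nonsing_inv_mul _ hYu, Matrix.one_mul] at h
  simpa only [Matrix.mul_assoc] using h

/-- **(C1) membership, `coe` form**: every `g : GL n R` whose matrix is the Cayley transform `(1+X)(1−X)⁻¹` of an `X` with `(σX)ᵀ J = −J X`,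
`1 − X` invertible, lies in the unitary group ★ `unitaryGroupOfForm σ J`. [cite: Mok2014, §1 Notation p. 5] -/
theorem mem_unitaryGroupOfForm_of_coe_eq_cayley (σ : R →+* R) {J X : Matrix n n R} (hX : (X.map σ)ᵀ * J = -(J * X))
    (h₁ : IsUnit (1 - X)) {g : GL n R} (hg : (g : Matrix n n R) = (1 + X) * (1 - X)⁻¹) :
    g ∈ unitaryGroupOfForm σ J := by
  rw [mem_unitaryGroupOfForm_iff, hg]
  exact transpose_map_mul_form_mul_cayley σ hX h₁

/-- **(C1) membership**: with `1 − X` AND `1 + X` invertible the Cayley transform IS an element of `GL n R` (★ `isUnit_cayley`), and that element lies in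
`unitaryGroupOfForm σ J`. [cite: Mok2014, §1 Notation p. 5] -/
theorem mem_unitaryGroupOfForm_cayley (σ : R →+* R) {J X : Matrix n n R} (hX : (X.map σ)ᵀ * J = -(J * X))
    (h₁ : IsUnit (1 - X)) (h₂ : IsUnit (1 + X)) :
    (isUnit_cayley h₁ h₂).unit ∈ unitaryGroupOfForm σ J :=
  mem_unitaryGroupOfForm_of_coe_eq_cayley σ hX h₁ (isUnit_cayley h₁ h₂).unit_spec

/-- **(C1) existential form for consumers**: `∃ g ∈ U(σ, J)` with matrix `(1+X)(1−X)⁻¹`. [cite: Mok2014, §1 Notation p. 5] -/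
theorem exists_mem_unitaryGroupOfForm_coe_eq_cayley (σ : R →+* R) {J X : Matrix n n R} (hX : (X.map σ)ᵀ * J = -(J * X))
    (h₁ : IsUnit (1 - X)) (h₂ : IsUnit (1 + X)) :
    ∃ g ∈ unitaryGroupOfForm σ J, (g : Matrix n n R) = (1 + X) * (1 - X)⁻¹ :=
  ⟨(isUnit_cayley h₁ h₂).unit, mem_unitaryGroupOfForm_cayley σ hX h₁ h₂, (isUnit_cayley h₁ h₂).unit_spec⟩

end Cayley

/-! ## §2 (C2) `1 ± X` are invertible off the roots `±1` of the characteristic polynomial -/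

section OneSubAdd

variable {R : Type*} [CommRing R] {n : Type*} [Fintype n] [DecidableEq n]

/-- `det (1 − X) = χ_X(1)` (Mathlib `Matrix.eval_charpoly`: `χ_X(t) = det (t·1 − X)`). [folklore] -/
theorem det_one_sub_eq_eval_charpoly (X : Matrix n n R) : (1 - X).det = X.charpoly.eval 1 := by
  rw [Matrix.eval_charpoly, map_one]

/-- `det (1 + X) = (−1)ⁿ χ_X(−1)` (`χ_X(−1) = det (−1 − X) = (−1)ⁿ det (1 + X)`). [folklore] -/
theorem det_one_add_eq_eval_charpoly (X : Matrix n n R) : (1 + X).det = (-1) ^ Fintype.card n * X.charpoly.eval (-1) := by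
  have hs : ((-1 : R) ^ Fintype.card n) * (-1) ^ Fintype.card n = 1 := by
    rw [← mul_pow, neg_one_mul, neg_neg, one_pow]
  have he : X.charpoly.eval (-1) = (-1) ^ Fintype.card n * (1 + X).det := by
    rw [Matrix.eval_charpoly, map_neg, map_one, show (-1 : Matrix n n R) - X = -(1 + X) by abel, Matrix.det_neg]
  rw [he, ← mul_assoc, hs, one_mul]

/-- `χ_X(1)` a unit ⇒ `1 − X` invertible. [folklore] -/
theorem isUnit_one_sub_of_isUnit_eval_charpoly {X : Matrix n n R} (h : IsUnit (X.charpoly.eval 1)) : IsUnit (1 - X) := by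
  rw [Matrix.isUnit_iff_isUnit_det, det_one_sub_eq_eval_charpoly]
  exact h

/-- `χ_X(−1)` a unit ⇒ `1 + X` invertible. [folklore] -/
theorem isUnit_one_add_of_isUnit_eval_charpoly {X : Matrix n n R} (h : IsUnit (X.charpoly.eval (-1))) : IsUnit (1 + X) := by
  rw [Matrix.isUnit_iff_isUnit_det, det_one_add_eq_eval_charpoly]
  exact (isUnit_one.neg.pow _).mul h

variable {K : Type*} [Field K] {m : Type*} [Fintype m] [DecidableEq m]

/-- **(C2) `1` not a root of `χ_X` ⇒ `1 − X` invertible** (field). [folklore] -/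
theorem isUnit_one_sub_of_not_isRoot {X : Matrix m m K} (h : ¬ X.charpoly.IsRoot 1) : IsUnit (1 - X) :=
  isUnit_one_sub_of_isUnit_eval_charpoly (isUnit_iff_ne_zero.2 h)

/-- **(C2) `−1` not a root of `χ_X` ⇒ `1 + X` invertible** (field). [folklore] -/
theorem isUnit_one_add_of_not_isRoot {X : Matrix m m K} (h : ¬ X.charpoly.IsRoot (-1)) : IsUnit (1 + X) :=
  isUnit_one_add_of_isUnit_eval_charpoly (isUnit_iff_ne_zero.2 h)

/-- An irreducible characteristic polynomial of a matrix of size `≥ 2` has no root. [folklore] -/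
theorem not_isRoot_charpoly_of_irreducible {X : Matrix m m K} (hirr : Irreducible X.charpoly) (hn : 2 ≤ Fintype.card m) (c : K) :
    ¬ X.charpoly.IsRoot c :=
  hirr.not_isRoot_of_natDegree_ne_one (by rw [Matrix.charpoly_natDegree_eq_dim]; omega)

/-- **(C2) `χ_X` irreducible and `n ≥ 2` ⇒ both `1 − X` and `1 + X` are invertible** (an irreducible polynomial of degree `≥ 2` has no root;
Mathlib `Irreducible.not_isRoot_of_natDegree_ne_one`, `Matrix.charpoly_natDegree_eq_dim`). [folklore] -/
theorem isUnit_one_sub_and_one_add_of_irreducible {X : Matrix m m K} (hirr : Irreducible X.charpoly) (hn : 2 ≤ Fintype.card m) :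
    IsUnit (1 - X) ∧ IsUnit (1 + X) :=
  ⟨isUnit_one_sub_of_not_isRoot (not_isRoot_charpoly_of_irreducible hirr hn 1),
    isUnit_one_add_of_not_isRoot (not_isRoot_charpoly_of_irreducible hirr hn (-1))⟩

end OneSubAdd

/-! ## §3 (C3′)+(C3) A rootless `χ_X` gives a rootless — for `n ≤ 3` irreducible — `χ_γ` -/

section Rootless

variable {K : Type*} [Field K] {n : Type*} [Fintype n] [DecidableEq n]

/-- `c·1 − γ = ((c−1)·1 − (c+1)·X)(1−X)⁻¹` for `γ = (1+X)(1−X)⁻¹`. [folklore] -/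
theorem scalar_sub_cayley {X : Matrix n n K} (h₁ : IsUnit (1 - X)) (c : K) :
    Matrix.scalar n c - (1 + X) * (1 - X)⁻¹ = ((c - 1) • (1 : Matrix n n K) - (c + 1) • X) * (1 - X)⁻¹ := by
  have hu := (Matrix.isUnit_iff_isUnit_det _).1 h₁
  have hsc : Matrix.scalar n c = c • (1 : Matrix n n K) := by
    rw [Matrix.scalar_apply, ← Matrix.smul_one_eq_diagonal]
  calc Matrix.scalar n c - (1 + X) * (1 - X)⁻¹
      = Matrix.scalar n c * (1 - X) * (1 - X)⁻¹ - (1 + X) * (1 - X)⁻¹ := by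
          conv_lhs => rw [← Matrix.mul_nonsing_inv_cancel_right (1 - X) (Matrix.scalar n c) hu]
    _ = (Matrix.scalar n c * (1 - X) - (1 + X)) * (1 - X)⁻¹ := by rw [sub_mul]
    _ = ((c - 1) • (1 : Matrix n n K) - (c + 1) • X) * (1 - X)⁻¹ := by
        congr 1
        rw [hsc, smul_mul_assoc, one_mul, smul_sub, sub_smul, add_smul, one_smul, one_smul]
        abel

/-- **`χ_γ(c) = det((c−1)·1 − (c+1)·X) · det(1−X)⁻¹`** for `γ = (1+X)(1−X)⁻¹` (field, `1 − X` invertible). [folklore] -/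
theorem eval_charpoly_cayley {X : Matrix n n K} (h₁ : IsUnit (1 - X)) (c : K) :
    ((1 + X) * (1 - X)⁻¹).charpoly.eval c = ((c - 1) • (1 : Matrix n n K) - (c + 1) • X).det * ((1 - X).det)⁻¹ := by
  rw [Matrix.eval_charpoly, scalar_sub_cayley h₁ c, Matrix.det_mul, Matrix.det_nonsing_inv, Ring.inverse_eq_inv']

/-- **(C3′) ROOTLESSNESS TRANSFERS ALONG THE CAYLEY TRANSFORM.**  Over a field with `2 ≠ 0`: if `χ_X` has no root then `χ_γ` has no root,
`γ = (1+X)(1−X)⁻¹` (for `c ≠ −1`, `det((c−1)·1 − (c+1)·X) = (c+1)ⁿ χ_X((c−1)/(c+1)) ≠ 0`; for `c = −1` it is `(−2)ⁿ ≠ 0`; and `det(1−X) = χ_X(1) ≠ 0`).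
This is the eigenvalue clause the LH6 test-element package (T3) consumes. [cite: Rogawski1990, §3.1 p. 19] -/
theorem not_isRoot_charpoly_cayley (h2 : (2 : K) ≠ 0) {X : Matrix n n K} (hX : ∀ c : K, ¬ X.charpoly.IsRoot c) (c : K) :
    ¬ ((1 + X) * (1 - X)⁻¹).charpoly.IsRoot c := by
  have h₁ : IsUnit (1 - X) := isUnit_one_sub_of_not_isRoot (hX 1)
  have hd : (1 - X).det ≠ 0 := ((Matrix.isUnit_iff_isUnit_det _).1 h₁).ne_zero
  intro hc
  rw [Polynomial.IsRoot.def, eval_charpoly_cayley h₁ c, mul_eq_zero] at hc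
  rcases hc with hM | hinv
  · by_cases hc1 : c + 1 = 0
    · -- `c = −1`: the matrix is `(−2)·1`
      have hc' : c - 1 = -2 := by linear_combination hc1
      rw [hc1, zero_smul, sub_zero, hc', Matrix.det_smul, Matrix.det_one, mul_one] at hM
      exact pow_ne_zero _ (neg_ne_zero.2 h2) hM
    · -- `c ≠ −1`: factor out `c + 1`
      have hq : (c + 1) * ((c - 1) / (c + 1)) = c - 1 := by field_simp
      have hM' : (c - 1) • (1 : Matrix n n K) - (c + 1) • X = (c + 1) • (Matrix.scalar n ((c - 1) / (c + 1)) - X) := by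
        rw [Matrix.scalar_apply, ← Matrix.smul_one_eq_diagonal, smul_sub, smul_smul, hq]
      rw [hM', Matrix.det_smul, ← Matrix.eval_charpoly, mul_eq_zero] at hM
      rcases hM with h | h
      · exact pow_ne_zero _ hc1 h
      · exact hX _ h
  · exact hd (inv_eq_zero.1 hinv)

/-- **(C3) IRREDUCIBILITY TRANSFERS (sizes `2` and `3`).**  Over a field with `2 ≠ 0`, for `2 ≤ n ≤ 3`: `χ_X` irreducible ⇒ `χ_γ` irreducible,
`γ = (1+X)(1−X)⁻¹` (degree `≤ 3`: irreducible ⟺ rootless, Mathlib `Polynomial.irreducible_of_degree_le_three_of_not_isRoot`; (C3′)).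
[cite: Rogawski1990, §3.1 p. 19] -/
theorem irreducible_charpoly_cayley (h2 : (2 : K) ≠ 0) (hn2 : 2 ≤ Fintype.card n) (hn3 : Fintype.card n ≤ 3) {X : Matrix n n K}
    (hirr : Irreducible X.charpoly) : Irreducible ((1 + X) * (1 - X)⁻¹).charpoly := by
  refine Polynomial.irreducible_of_degree_le_three_of_not_isRoot ?_
    (not_isRoot_charpoly_cayley h2 (not_isRoot_charpoly_of_irreducible hirr hn2))
  rw [Matrix.charpoly_natDegree_eq_dim, Finset.mem_Icc]
  omega

/-- **(C3) at `3 × 3`**: `χ_X` irreducible ⇒ `χ_γ` irreducible for `γ = (1+X)(1−X)⁻¹`, over any field with `2 ≠ 0` (e.g. the local fields `L_w`).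
[cite: Rogawski1990, §3.1 p. 19] -/
theorem irreducible_charpoly_cayley_fin_three (h2 : (2 : K) ≠ 0) {X : Matrix (Fin 3) (Fin 3) K} (hirr : Irreducible X.charpoly) :
    Irreducible ((1 + X) * (1 - X)⁻¹).charpoly :=
  irreducible_charpoly_cayley h2 (by simp) (by simp) hirr

/-- **The package the consumer calls** (`3 × 3`, field with `2 ≠ 0`): an `X` in the Lie algebra of the form (`(σX)ᵀ J = −J X`) with irreducible `χ_X`
has a Cayley transform `g ∈ U(σ, J)` with matrix `(1+X)(1−X)⁻¹` and IRREDUCIBLE (hence rootless, separable over a perfect field) characteristic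
polynomial. [cite: Rogawski1990, §3.1 p. 19] [cite: Mok2014, §1 Notation p. 5] -/
theorem exists_mem_unitaryGroupOfForm_irreducible_charpoly_of_cayley (σ : K →+* K) (h2 : (2 : K) ≠ 0) {J X : Matrix (Fin 3) (Fin 3) K}
    (hX : (X.map σ)ᵀ * J = -(J * X)) (hirr : Irreducible X.charpoly) :
    ∃ g ∈ unitaryGroupOfForm σ J, (g : Matrix (Fin 3) (Fin 3) K) = (1 + X) * (1 - X)⁻¹ ∧
      Irreducible (g : Matrix (Fin 3) (Fin 3) K).charpoly := by
  obtain ⟨h₁, h₂⟩ := isUnit_one_sub_and_one_add_of_irreducible hirr (by simp)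
  obtain ⟨g, hg, hcoe⟩ := exists_mem_unitaryGroupOfForm_coe_eq_cayley σ hX h₁ h₂
  exact ⟨g, hg, hcoe, hcoe ▸ irreducible_charpoly_cayley_fin_three h2 hirr⟩

end Rootless

end Summit.HodgeConjecture.HodgeConjecture.Cruxes.H413.F0P3cStCharTSCayleyUnitary
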